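import Summits.AnomalousDissipation.AnomalousDissipation.Theorems.MarginalStabilityChainStrainedLayerLawClockComposition
import Summits.AnomalousDissipation.AnomalousDissipation.Theorems.MarginalStabilityChainStrainedLayerLawClockStubCirculationFloor
import Summits.AnomalousDissipation.AnomalousDissipation.Theorems.MarginalStabilityChainStrainedLayerLawClockStubLevelSetNull
import Summits.AnomalousDissipation.AnomalousDissipation.Theorems.MarginalStabilityChainStrainedLayerLawClockStubNegEnstrophyLaw
import Summits.AnomalousDissipation.AnomalousDissipation.Theorems.MarginalStabilityChainStrainedLayerLawClockStubNegEnstrophyApriori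
import Summits.AnomalousDissipation.AnomalousDissipation.Theorems.MarginalStabilityChainStrainedLayerLawSumRuleShearTails

/-!
# Crux `MarginalStabilityChain.StrainedLayerLaw` (stmt-AnomalousDissipation-3007), line `FirstLemmasR2K4`
# (log-enstrophy clock + Nash roundness): the TWO-HYPOTHESIS REDUCTION (kernel-checked)

Support file (`--supports stmt-AnomalousDissipation-3007`; registered sub-goals `StrainedLayerLaw_of_roundnessFloor`,
`StrainedLayerLaw_of_roundnessFloor_of_hasShearLayerTails`, `clock_log_identity`, `clock_magnitude_law`). With the four analysis stubs of the line landed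
(`stub_circulationFloor` p125277, `stub_levelSetNull` p125255, `stub_negEnstrophyLaw` p126337, `stub_negEnstrophyApriori`
p125290) the conditional composition `StrainedLayerLaw_of_clockStubs` (p124965) specialises to:

* `StrainedLayerLaw_of_roundnessFloor` — the crux BY NAME follows from exactly two statements: (H) the hygiene stub
  `stub_bareClassTails` (finite-dissipation members of the bare class have shear tails on compact time intervals — the
  sum-rule line's registered signature; repair-only in the bare class) and (B3) the ROUNDNESS FLOOR `stub_roundnessFloor`
  (eventual Nash roundness `(r⋆ min(L,1)/L)·M₋²P₋ ≤ Ω₋²` of the negative vorticity along every finite-dissipation tailed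
  member from one admissible `θ`, for all small `ν`): the crux's whole analytic content (clock, circulation, zero set,
  a-priori bounds, transfer) is discharged, and what is left is hygiene + ONE scale-free shape statement;
* `StrainedLayerLaw_of_roundnessFloor_of_hasShearLayerTails` — the same with (H) replaced by its form under the recommended
  class repair: if every member of the crux's class has shear-layer tails (`HasShearLayerTails u v`, Literature p113456),
  then (B3) ALONE proves the crux (via the landed `bareClassTails_of_hasShearLayerTails`, p120875).

* the clock's A-PRIORI MAGNITUDE LAW, unconditional for tailed solutions (`clock_log_identity`,
  `clock_magnitude_law`): `log Ω₋(T) − log Ω₋(t₁) = (T − t₁) − ∫_{t₁}^T 2νP₋/Ω₋`, hence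
  `∫_{t₁}^T 2νP₋/Ω₋ ≥ (T − t₁) + log Ω₋(t₁) − log B` — the time-mean of `2νP₋/Ω₋` is asymptotically ≥ 1 whatever the
  dynamics (the crux's magnitude half, discharged by an identity; the roundness floor is exactly what converts it into
  the dissipation floor).

No facts are asserted. Line lead a2, 2026-08-16.
-/

-- `Summit.<Summit>.<Problem>` is the tree's mandated summit-side namespace (CONVENTIONS §2); for this
-- single-conjunct summit the two coincide, so the duplicate is deliberate.
set_option linter.dupNamespace false

noncomputable section

open scoped Topology ENNReal
open Filter Set Function MeasureTheory

namespace Summit.AnomalousDissipation.AnomalousDissipation.Theorems.StrainedLayerLaw.LogEnstrophyClock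

open Literature.Analysis.FluidPDE Literature.Analysis.FluidPDE.StretchedLayer
open Summit.AnomalousDissipation.AnomalousDissipation.Theses.MarginalStabilityChain
open Summit.AnomalousDissipation.AnomalousDissipation.Theorems.StrainedLayerLaw.StrainWorkSumRule

/-- **The crux ⇐ hygiene + roundness floor (kernel-checked two-hypothesis reduction).** Feed the landed stubs of the
clock line to `StrainedLayerLaw_of_clockStubs`: only the hygiene stub (h3) and the roundness floor (hB3) remain as
hypotheses. [folklore] -/
theorem StrainedLayerLaw_of_roundnessFloor
    (h3 : ∀ (ν L : ℝ), 0 < ν → 0 < L → ∀ (θ₁ θ₂ : ℝ → ℝ → ℝ), IsAdmissible L θ₁ θ₂ →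
        ∀ (u v p : ℝ → ℝ → ℝ → ℝ), InCruxClass ν L θ₁ θ₂ u v p →
          (∀ T : ℝ, 0 < T → ∫⁻ t in Ioc 0 T, layerDissipation ν L (u t) (v t) ≠ ∞) →
            ∀ a b : ℝ, 0 < a → a < b → ExpTails (Icc a b) u v)
    (hB3 : ∃ r : ℝ, 0 < r ∧ ∀ L : ℝ, 0 < L → ∃ ν₀ : ℝ, 0 < ν₀ ∧ ∃ θ₁ θ₂ : ℝ → ℝ → ℝ,
        IsAdmissible L θ₁ θ₂ ∧
        ∀ ν : ℝ, 0 < ν → ν ≤ ν₀ → ∀ (u v p : ℝ → ℝ → ℝ → ℝ), InCruxClass ν L θ₁ θ₂ u v p →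
          (∀ T : ℝ, 0 < T → ∫⁻ t in Ioc 0 T, layerDissipation ν L (u t) (v t) ≠ ∞) →
          (∀ a b : ℝ, 0 < a → a < b → ExpTails (Icc a b) u v) →
            ∃ T₁ : ℝ, 0 < T₁ ∧ ∀ t : ℝ, T₁ ≤ t →
              r * min L 1 / L * negMass L (u t) (v t) ^ 2 * negPalinstrophy L (u t) (v t) ≤
                negEnstrophy L (u t) (v t) ^ 2) :
    StrainedLayerLaw :=
  StrainedLayerLaw_of_clockStubs h3 stub_circulationFloor stub_levelSetNull stub_negEnstrophyLaw
    stub_negEnstrophyApriori hB3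

/-- **Under the class repair the roundness floor ALONE proves the crux (kernel-checked).** If every member of the crux's
class has shear-layer tails (`HasShearLayerTails`, the recommended side condition; then the hygiene stub is the landed
`bareClassTails_of_hasShearLayerTails`), the roundness floor (hB3) implies `StrainedLayerLaw`. [folklore] -/
theorem StrainedLayerLaw_of_roundnessFloor_of_hasShearLayerTails
    (hrepair : ∀ (ν L : ℝ), 0 < ν → 0 < L → ∀ (θ₁ θ₂ : ℝ → ℝ → ℝ), IsAdmissible L θ₁ θ₂ →
        ∀ (u v p : ℝ → ℝ → ℝ → ℝ), InCruxClass ν L θ₁ θ₂ u v p → HasShearLayerTails u v)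
    (hB3 : ∃ r : ℝ, 0 < r ∧ ∀ L : ℝ, 0 < L → ∃ ν₀ : ℝ, 0 < ν₀ ∧ ∃ θ₁ θ₂ : ℝ → ℝ → ℝ,
        IsAdmissible L θ₁ θ₂ ∧
        ∀ ν : ℝ, 0 < ν → ν ≤ ν₀ → ∀ (u v p : ℝ → ℝ → ℝ → ℝ), InCruxClass ν L θ₁ θ₂ u v p →
          (∀ T : ℝ, 0 < T → ∫⁻ t in Ioc 0 T, layerDissipation ν L (u t) (v t) ≠ ∞) →
          (∀ a b : ℝ, 0 < a → a < b → ExpTails (Icc a b) u v) →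
            ∃ T₁ : ℝ, 0 < T₁ ∧ ∀ t : ℝ, T₁ ≤ t →
              r * min L 1 / L * negMass L (u t) (v t) ^ 2 * negPalinstrophy L (u t) (v t) ≤
                negEnstrophy L (u t) (v t) ^ 2) :
    StrainedLayerLaw :=
  StrainedLayerLaw_of_roundnessFloor
    (fun ν L hν hL θ₁ θ₂ hθ u v p hcl hfin a b ha hab =>
      bareClassTails_of_hasShearLayerTails ν L hν hL θ₁ θ₂ hθ u v p hcl (hrepair ν L hν hL θ₁ θ₂ hθ u v p hcl)
        hfin a b ha hab)
    hB3

/-! ## The clock's a-priori magnitude law (UNCONDITIONAL for tailed solutions; the crux's "magnitude half") -/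

/-- **Positivity and boundedness of `Ω₋` along a tailed solution (landed stubs B2 and A combined).** For `t > 0`,
`0 < Ω₋(t)` (circulation floor `M₋ ≥ L > 0`, then `stub_negEnstrophyApriori` (ii)); and `Ω₋(t) ≤ B` for `t ≥ 1`.
[folklore] -/
theorem clock_negEnstrophy_pos_and_bounded {ν L : ℝ} (hν : 0 < ν) (hL : 0 < L) {u v p : ℝ → ℝ → ℝ → ℝ}
    (hsol : IsStretchedLayerNSSolutionOn (Ioi 0) ν 1 1 L u v p)
    (htails : ∀ a b : ℝ, 0 < a → a < b → ExpTails (Icc a b) u v) :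
    (∀ t : ℝ, 0 < t → 0 < negEnstrophy L (u t) (v t)) ∧
      ∃ B : ℝ, ∀ t : ℝ, 1 ≤ t → negEnstrophy L (u t) (v t) ≤ B := by
  obtain ⟨hB, hpos⟩ := stub_negEnstrophyApriori ν L hν hL u v p hsol htails
  refine ⟨fun t ht => hpos t ht (hL.trans_le ?_), hB⟩
  obtain ⟨C, k, hk, hCk⟩ := htails t (t + 1) ht (lt_add_one t)
  have hST : SliceTails C k (u t) (v t) := (hCk t ⟨le_rfl, (lt_add_one t).le⟩).1
  have ht' : t ∈ Ioi (0 : ℝ) := ht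
  exact stub_circulationFloor L C k hL hk (u t) (v t) (hsol.contDiff_u ht') (hsol.contDiff_v ht')
    (hsol.periodic_u t ht') (hsol.periodic_v t ht') (by simpa using hsol.tendsto_u_atTop t ht')
    (by simpa using hsol.tendsto_u_atBot t ht') hST

/-- **The log-enstrophy clock identity (exact, unconditional for tailed solutions).** Along every classical solution
of the stretched layer class on `(0,∞)` with shear tails on compact time intervals, for `0 < t₁ ≤ T`:
`log Ω₋(T) − log Ω₋(t₁) = (T − t₁) − ∫_{t₁}^T 2νP₋/Ω₋` — the unit rate is the axial stretching; in unstretched 2-D the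
same computation has no `+1` (the Alexakis–Doering enstrophy ceiling read as an identity). Proof: `(log Ω₋)′ =
(Ω₋ − 2νP₋)/Ω₋` (`stub_negEnstrophyLaw` fed with `stub_levelSetNull`, `Ω₋ > 0`), the derivative is continuous on `(0,∞)`
(`clock_negEnstrophy_continuousOn`), fundamental theorem of calculus. [folklore] -/
theorem clock_log_identity {ν L : ℝ} (hν : 0 < ν) (hL : 0 < L) {u v p : ℝ → ℝ → ℝ → ℝ}
    (hsol : IsStretchedLayerNSSolutionOn (Ioi 0) ν 1 1 L u v p)
    (htails : ∀ a b : ℝ, 0 < a → a < b → ExpTails (Icc a b) u v) {t₁ T : ℝ} (ht₁ : 0 < t₁) (hT : t₁ ≤ T) :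
    Real.log (negEnstrophy L (u T) (v T)) - Real.log (negEnstrophy L (u t₁) (v t₁)) =
      (T - t₁) - ∫ t in t₁..T, 2 * ν * negPalinstrophy L (u t) (v t) / negEnstrophy L (u t) (v t) := by
  set Ω : ℝ → ℝ := fun t => negEnstrophy L (u t) (v t) with hΩ
  set P : ℝ → ℝ := fun t => negPalinstrophy L (u t) (v t) with hP
  have hderiv : ∀ t, 0 < t → HasDerivAt Ω (Ω t - 2 * ν * P t) t :=
    stub_negEnstrophyLaw stub_levelSetNull ν L hν hL u v p hsol htails
  have hpos : ∀ t, 0 < t → 0 < Ω t := (clock_negEnstrophy_pos_and_bounded hν hL hsol htails).1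
  -- the derivative of `log Ω` and its continuity on `(0, ∞)`
  have hlog : ∀ t, 0 < t → HasDerivAt (fun s => Real.log (Ω s)) ((Ω t - 2 * ν * P t) / Ω t) t :=
    fun t ht => (hderiv t ht).log (hpos t ht).ne'
  have hgc : ContinuousOn (fun t => Ω t - 2 * ν * P t) (Ioi 0) :=
    clock_negEnstrophy_continuousOn stub_levelSetNull hsol htails
  have hΩc : ContinuousOn Ω (Ioi 0) := fun t ht => (hderiv t ht).continuousAt.continuousWithinAt
  have hqc : ContinuousOn (fun t => (Ω t - 2 * ν * P t) / Ω t) (Ioi 0) :=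
    hgc.div hΩc fun t ht => (hpos t ht).ne'
  have hsub : uIcc t₁ T ⊆ Ioi 0 := fun t ht => by
    rw [uIcc_of_le hT] at ht; exact ht₁.trans_le ht.1
  have hint : IntervalIntegrable (fun t => (Ω t - 2 * ν * P t) / Ω t) volume t₁ T :=
    (hqc.mono hsub).intervalIntegrable
  have hftc := intervalIntegral.integral_eq_sub_of_hasDerivAt (fun t ht => hlog t (hsub ht)) hint
  -- split the integrand `(Ω − 2νP)/Ω = 1 − 2νP/Ω`
  have hPc : ContinuousOn (fun t => 2 * ν * P t / Ω t) (Ioi 0) := by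
    have h2 : ContinuousOn (fun t => 2 * ν * P t) (Ioi 0) := by
      have := hΩc.sub hgc
      refine this.congr fun t _ => ?_
      show 2 * ν * P t = Ω t - (Ω t - 2 * ν * P t)
      ring
    exact h2.div hΩc fun t ht => (hpos t ht).ne'
  have hint2 : IntervalIntegrable (fun t => 2 * ν * P t / Ω t) volume t₁ T := (hPc.mono hsub).intervalIntegrable
  have hsplit : ∫ t in t₁..T, (Ω t - 2 * ν * P t) / Ω t = (T - t₁) - ∫ t in t₁..T, 2 * ν * P t / Ω t := by
    have hcongr : ∫ t in t₁..T, (Ω t - 2 * ν * P t) / Ω t = ∫ t in t₁..T, ((1 : ℝ) - 2 * ν * P t / Ω t) := by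
      apply intervalIntegral.integral_congr
      intro t ht
      have hΩt : Ω t ≠ 0 := (hpos t (hsub ht)).ne'
      show (Ω t - 2 * ν * P t) / Ω t = 1 - 2 * ν * P t / Ω t
      field_simp
    rw [hcongr, intervalIntegral.integral_sub intervalIntegrable_const hint2, intervalIntegral.integral_const,
      smul_eq_mul, mul_one]
  rw [← hftc, hsplit]

/-- **The clock's magnitude law (the crux's magnitude half, UNCONDITIONAL for tailed solutions).** Along every
classical solution of the stretched layer class on `(0,∞)` with shear tails on compact time intervals there is `B` (the
fixed-ν enstrophy bound) such that for all `1 ≤ t₁ ≤ T`: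
`(T − t₁) + log Ω₋(t₁) − log B ≤ ∫_{t₁}^T 2νP₋/Ω₋` — the time-mean of the palinstrophy-to-enstrophy ratio `2νP₋/Ω₋` is
asymptotically at least ONE, whatever the dynamics and uniformly in the form of the bound (ν enters only through `log B`).
With the roundness floor `P₋ ≤ Ω₋²/(r₀M₋²)` and `M₋ ≥ L` this is `clockTransfer`; without it, it is the exact a-priori
content of the line. [folklore] -/
theorem clock_magnitude_law {ν L : ℝ} (hν : 0 < ν) (hL : 0 < L) {u v p : ℝ → ℝ → ℝ → ℝ}
    (hsol : IsStretchedLayerNSSolutionOn (Ioi 0) ν 1 1 L u v p)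
    (htails : ∀ a b : ℝ, 0 < a → a < b → ExpTails (Icc a b) u v) :
    ∃ B : ℝ, ∀ t₁ T : ℝ, 1 ≤ t₁ → t₁ ≤ T →
      (T - t₁) + Real.log (negEnstrophy L (u t₁) (v t₁)) - Real.log B ≤
        ∫ t in t₁..T, 2 * ν * negPalinstrophy L (u t) (v t) / negEnstrophy L (u t) (v t) := by
  obtain ⟨hpos, B, hB⟩ := clock_negEnstrophy_pos_and_bounded hν hL hsol htails
  refine ⟨B, fun t₁ T ht₁ hT => ?_⟩
  have h01 : 0 < t₁ := one_pos.trans_le ht₁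
  have hid := clock_log_identity hν hL hsol htails h01 hT
  have hlogT : Real.log (negEnstrophy L (u T) (v T)) ≤ Real.log B :=
    Real.log_le_log (hpos T (h01.trans_le hT)) (hB T (ht₁.trans hT))
  linarith

end Summit.AnomalousDissipation.AnomalousDissipation.Theorems.StrainedLayerLaw.LogEnstrophyClock

end
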